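import Summits.PneNP.PneNP.Theorems.NegLimitedDoorQuartCliqueSlices

/-!
# Route NegLimited — ladder support `RecurringCliqueSlicesNP` (line `density-ladder`, stub 5; rung F-N1/p3, ROUND-9 §B)

Registered stub `stub_recurringCliqueSlicesNP` of the skeleton `density-ladder`
(HOME/pnp-ideate-p3/r9/ladder/density-ladder.lean, sha 2d55ebf8) on the support item
`NegLimited.NeglimitedLogOverOmegaNegations` (stmt-PneNP-19555): ONE `NP` language in which, for
every clique size `k` and EVERY number of vertices `m > k`, the problem `CLIQUE(m, k)` is (a retract
of) the monotone slice at length `n = m² + k ∈ [m, m⁴]`.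

The witness (the clique size is read off the LENGTH, not off extra input bits): a string `u` of
length `m² + k` (`m = ⌊√|u|⌋`, `k = |u| mod m`, valid for `k < m`) is in `recCliqueLang` iff the
upper-triangle graph of its square part `u ↾ m²` has a clique on `k` vertices; the last `k` bits are
padding. The verifier is the quart-clique verifier of `NegLimitedDoorQuartCliqueSlices.lean` run on
the reshaped pair `⟨u ↾ m², y⟩` (`Plumb.takeFn` at the ruler `1^{m²} = Plumb.polyFn (X·X) (1ᵐ)`), with
the count test re-targeted to `1ᵏ = Plumb.modLenFn ⟨1ᵐ, u⟩`; its `FP` membership and the values of the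
popcount / edge bricks on square matrices are the public lemmas of that file
(`QuartCliqueVerifier.parts_mem_FP`, `popFn_sq4`, `edgesOK_sq4`). The slice at length `m² + k` is
`cliqueFn m k ∘ edgeVec ∘ (· ↾ m²)` (`sliceFn_recCliqueLang`), monotone, and lower bounds transfer
along the upper-triangle retraction (`NegLimSlices.le_negLimitedSizeOver_of_retract`).

References: S. Arora, B. Barak, *Computational Complexity* (2009), §1.3, §2.1 Ex. 2.2
[AroraBarakCC2009]; B. Rossman, *The monotone complexity of k-clique on random graphs*, FOCS 2010,
Thm. 1 (the fixed-`k` engine this slice plumbing serves) [Rossman2010].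
-/

set_option linter.dupNamespace false -- `Summit.PneNP.PneNP.…`: summit = sub-problem name (D-0017 single-conjunct layout)

noncomputable section

namespace Summit.PneNP.PneNP.Theorems.NegLimitedLadder

open Finset Filter
open Literature.Computability.Complexity Literature.Computability.Complexity.Brick
  Literature.Computability.Complexity.CliqueVerifier Literature.Barriers.PneNP
  Summit.PneNP.PneNP.Theorems.NegLimSlices Summit.PneNP.PneNP.Theorems.NegLimitedDoor
  Summit.PneNP.PneNP.Theorems.NegLimitedDoor.QuartCliqueVerifier _root_.Computability Polynomial

/-- The stub statement `RecurringCliqueSlicesNP` (verbatim from the registered skeleton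
`density-ladder`): ONE NP language in which, for every fixed `k ≥ 5`, the `k`-clique problem on `m`
vertices recurs as (a retract of) a monotone slice at infinitely many `m`, at a length `n ∈ [m, m⁴]`. -/
def RecurringCliqueSlicesNP : Prop :=
  ∃ L ∈ Literature.Computability.Complexity.Nondeterministic.NP, ∀ k : ℕ, 5 ≤ k → ∀ m₀ : ℕ, ∃ m : ℕ,
    m₀ ≤ m ∧ ∃ n : ℕ, m ≤ n ∧ n ≤ m ^ 4 ∧ Monotone (L.sliceFn n) ∧
      ∀ b s : ℕ, (∀ D : Literature.Computability.Complexity.Circuit ↥(⊤ : SimpleGraph (Fin m)).edgeSet,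
        D.IsOver deMorganBasis → D.Computes (cliqueFn m k) → D.negationCount ≤ b → s ≤ D.size) →
        s ≤ negLimitedSizeOver deMorganBasis b (L.sliceFn n)

namespace RecurringCliqueVerifier

/-! ## The recurring-clique verifier -/

/-- **Acceptance test**: the first `m` bits of the certificate mark exactly `k` vertices, every two
of which are joined in the upper triangle of the square part `u ↾ m²`.
[cite: AroraBarak2009, §2.1 Ex. 2.2] -/
def acceptsR (u y : List Bool) (m k : ℕ) : Bool :=
  decide ((y.take m).count true = k) &&
    decide (∀ t, t < m * m → t / m < t % m → (y.take m).getD (t / m) false = true →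
      (y.take m).getD (t % m) false = true → (u.take (m * m)).getD t false = true)

/-- Unfolding the acceptance test. [cite: AroraBarak2009, §2.1 Ex. 2.2] -/
theorem acceptsR_eq_true_iff {u y : List Bool} {m k : ℕ} :
    acceptsR u y m k = true ↔ (y.take m).count true = k ∧
      ∀ t, t < m * m → t / m < t % m → (y.take m).getD (t / m) false = true →
        (y.take m).getD (t % m) false = true → (u.take (m * m)).getD t false = true := by
  simp only [acceptsR, Bool.and_eq_true, decide_eq_true_iff]

/-- The square part `u ↾ m²` of the input (`m = ⌊√|u|⌋`; ruler `1^{m²}`). [folklore] -/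
def sqU : List Bool → List Bool := Plumb.takeFn ∘ fanoutFn (Plumb.polyFn (X * X) ∘ vM) vU

/-- The reshaped pair `⟨u ↾ m², y⟩`. [folklore] -/
def reshape : List Bool → List Bool := fanoutFn sqU vY

/-- The clique size `1ᵏ`, `k = |u| mod m`. [folklore] -/
def vKR : List Bool → List Bool := Plumb.modLenFn ∘ fanoutFn vM vU

/-- The count test `[#ones of y' = k]`. [folklore] -/
def cntR : List Bool → List Bool := eqPairFn ∘ fanoutFn (popFn ∘ reshape) vKR

/-- **The recurring-clique verifier**: re-targeted count test, and the edge test on the square part.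
[cite: AroraBarak2009, §2.1 Ex. 2.2] -/
def verR : List Bool → List Bool := andFn cntR (edgesOK ∘ reshape)

/-! ### Polynomial time -/

/-- The reshaping is in `FP`. [cite: AroraBarakCC2009, §1.3] -/
theorem reshape_mem_FP : reshape ∈ FP := by
  obtain ⟨hM, -, -, -, -⟩ := parts_mem_FP
  exact fanoutFn_mem_FP (comp_mem_FP Plumb.takeFn_mem_FP
    (fanoutFn_mem_FP (comp_mem_FP (Plumb.polyFn_mem_FP _) hM) fstF_mem_FP)) sndF_mem_FP

/-- **`verR ∈ FP`.** [cite: AroraBarakCC2009, §1.3 (bounded loops)] -/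
theorem verR_mem_FP : verR ∈ FP := by
  obtain ⟨hM, -, -, hpop, hedges⟩ := parts_mem_FP
  have hKR : vKR ∈ FP := comp_mem_FP Plumb.modLenFn_mem_FP (fanoutFn_mem_FP hM fstF_mem_FP)
  exact andFn_mem_FP
    (comp_mem_FP eqPairFn_mem_FP (fanoutFn_mem_FP (comp_mem_FP hpop reshape_mem_FP) hKR))
    (comp_mem_FP hedges reshape_mem_FP)

/-! ### Semantics at the lengths `m² + k`, `k < m` -/

variable {u y : List Bool} {m k : ℕ}

/-- The side: `vM ⟨u, y⟩ = 1ᵐ` for `|u| = m² + k`, `k ≤ 2m`. [folklore] -/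
theorem vM_len (hu : u.length = m * m + k) (hk : k ≤ m + m) : vM (boolPair u y) = ones m := by
  simp only [vM, vU, Function.comp_apply, fanoutFn_apply, fstF_boolPair, isqrtFn_apply,
    binToUnaryFn_boolPair, bitsToNat_encodeNat, hu, Nat.sqrt_add_eq m hk]
  rw [min_eq_left ((Nat.le_mul_self m).trans (Nat.le_add_right _ _))]

/-- The reshaped pair: `reshape ⟨u, y⟩ = ⟨u ↾ m², y⟩` for `|u| = m² + k`, `k ≤ 2m`. [folklore] -/
theorem reshape_len (hu : u.length = m * m + k) (hk : k ≤ m + m) :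
    reshape (boolPair u y) = boolPair (u.take (m * m)) y := by
  simp only [reshape, sqU, vY, vU, Function.comp_apply, fanoutFn_apply, vM_len hu hk, fstF_boolPair,
    sndF_boolPair, Plumb.polyFn_apply, Plumb.takeFn_boolPair, eval_mul, eval_X]
  simp [ones]

/-- The clique size: `vKR ⟨u, y⟩ = 1ᵏ` for `|u| = m² + k`, `k < m`. [folklore] -/
theorem vKR_len (hu : u.length = m * m + k) (hk : k < m) : vKR (boolPair u y) = ones k := by
  simp only [vKR, vU, Function.comp_apply, fanoutFn_apply, vM_len hu (by omega), fstF_boolPair,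
    Plumb.modLenFn_boolPair, hu]
  rw [show m * m + k = k + m * m from Nat.add_comm _ _, Nat.add_mul_mod_self_left, Nat.mod_eq_of_lt hk]

/-- **Value of the count test.** [folklore] -/
theorem cntR_len (hu : u.length = m * m + k) (hk : k < m) :
    cntR (boolPair u y) = [decide ((y.take m).count true = k)] := by
  have hu' : (u.take (m * m)).length = m * m := by simp [hu]
  simp only [cntR, Function.comp_apply, fanoutFn_apply, reshape_len hu (by omega), popFn_sq4 hu',
    vKR_len hu hk, eqPairFn_boolPair]
  congr 1
  rw [Bool.eq_iff_iff, decide_eq_true_iff, decide_eq_true_iff]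
  constructor
  · intro h; simpa [ones] using congrArg List.length h
  · intro h; rw [h]

/-- **Value of the edge test on the square part.** [folklore] -/
theorem edgesR_len (hu : u.length = m * m + k) (hk : k < m) :
    (edgesOK ∘ reshape) (boolPair u y) = [decide (∀ t, t < m * m → t / m < t % m →
      (y.take m).getD (t / m) false = true → (y.take m).getD (t % m) false = true →
        (u.take (m * m)).getD t false = true)] := by
  have hu' : (u.take (m * m)).length = m * m := by simp [hu]
  rw [Function.comp_apply, reshape_len hu (by omega), edgesOK_sq4 hu']

/-- **The recurring-clique verifier at length `m² + k`** (`k < m`): `verR ⟨u, y⟩ = [acceptsR u y m k]`.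
[cite: AroraBarak2009, §2.1 Ex. 2.2] -/
theorem verR_len (hu : u.length = m * m + k) (hk : k < m) :
    verR (boolPair u y) = [acceptsR u y m k] := by
  rw [verR, andFn_apply (cntR_len hu hk) (edgesR_len hu hk), acceptsR]

end RecurringCliqueVerifier

open RecurringCliqueVerifier

/-! ## The language, its membership in `NP`, its slices at the lengths `m² + k` -/

/-- The verifier language `{z | verR z = 1}`. [folklore] -/
def recCliqueVerLang : Language Bool := {z | verR z = [true]}

/-- Membership in the verifier language. [folklore] -/
theorem mem_recCliqueVerLang {z : List Bool} : z ∈ recCliqueVerLang ↔ verR z = [true] := Iff.rfl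

/-- The verifier language is in `P`. [cite: AroraBarakCC2009, Thm. 2.8] -/
theorem recCliqueVerLang_mem_P : recCliqueVerLang ∈ Classes.P :=
  setOf_apply_eq_apply_mem_P verR_mem_FP (const_mem_FP [true])

/-- **The recurring-clique language**: strings `u` with a certificate `y`, `|y| ≤ |u|`, accepted by
the recurring-clique verifier. [cite: AroraBarak2009, §2.1 Ex. 2.2] -/
def recCliqueLang : Language Bool :=
  {u | ∃ y : List Bool, y.length ≤ (X : Polynomial ℕ).eval u.length ∧ boolPair u y ∈ recCliqueVerLang}

/-- **`recCliqueLang ∈ NP`** (certificate definition). [cite: AroraBarak2009, Def. 2.1] -/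
theorem recCliqueLang_mem_NP : recCliqueLang ∈ Nondeterministic.NP :=
  mem_NP_iff_verifier.2 ⟨recCliqueVerLang, recCliqueVerLang_mem_P, X, fun _ => Iff.rfl⟩

variable {m k : ℕ}

/-- The square part of an input of length `m² + k`: its first `m²` bits. [folklore] -/
def sqPart (w : Fin (m * m + k) → Bool) : Fin (m * m) → Bool :=
  fun i => w (Fin.castLE (Nat.le_add_right _ _) i)

/-- The list of the square part is the `m²`-prefix of the list of the input. [folklore] -/
theorem take_ofFn_eq_ofFn_sqPart (w : Fin (m * m + k) → Bool) :
    (List.ofFn w).take (m * m) = List.ofFn (sqPart w) := by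
  apply List.ext_getElem
  · simp
  · intro i h₁ h₂
    simp [sqPart, List.getElem_take, List.getElem_ofFn]

/-- **Slices of the recurring-clique language at the lengths `m² + k` (`1 ≤ m`, `k < m`), in matrix
coordinates**: `L(w) = 1` iff some `k`-set `S` of vertices has `w_{b + m·a} = 1` for all `a < b` in
`S`. [cite: AroraBarak2009, §2.1 Ex. 2.2] -/
theorem sliceFn_recCliqueLang_eq_true_iff (hm : 1 ≤ m) (hk : k < m) (w : Fin (m * m + k) → Bool) :
    recCliqueLang.sliceFn (m * m + k) w = true ↔ ∃ S : Finset (Fin m),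
      S.card = k ∧ ∀ a ∈ S, ∀ b ∈ S, a < b →
        ∀ h : (b : ℕ) + m * (a : ℕ) < m * m, sqPart w ⟨(b : ℕ) + m * (a : ℕ), h⟩ = true := by
  have hm0 : 0 < m := hm
  have hu : (List.ofFn w).length = m * m + k := by simp
  have hdiv : ∀ a b : ℕ, b < m → (b + m * a) / m = a := fun a b hb => by
    rw [Nat.add_mul_div_left _ _ hm0, Nat.div_eq_of_lt hb, zero_add]
  have hmod : ∀ a b : ℕ, b < m → (b + m * a) % m = b := fun a b hb => by
    rw [Nat.add_mul_mod_self_left, Nat.mod_eq_of_lt hb]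
  show recCliqueLang.boolIndicator (List.ofFn w) = true ↔ _
  rw [← Set.mem_iff_boolIndicator, recCliqueLang, Set.mem_setOf_eq]
  simp only [mem_recCliqueVerLang, verR_len hu hk, List.cons.injEq, and_true, eval_X, hu,
    acceptsR_eq_true_iff, take_ofFn_eq_ofFn_sqPart]
  constructor
  · -- a certificate gives a clique
    rintro ⟨y, -, hcnt, hedge⟩
    refine ⟨Finset.univ.filter fun a : Fin m => (y.take m).getD a false = true, ?_, ?_⟩
    · rw [card_filter_univ_fin m fun i => (y.take m).getD i false = true,
        card_filter_range_getD _ (by simp), hcnt]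
    · intro a ha b hb hab h
      simp only [Finset.mem_filter, Finset.mem_univ, true_and] at ha hb
      have hab' : (a : ℕ) < b := hab
      have h1 := hedge _ h
      rw [hdiv _ _ b.2, hmod _ _ b.2] at h1
      rw [← Kannan.getD_ofFn (sqPart w) h]
      exact h1 hab' ha hb
  · -- a clique gives a certificate
    rintro ⟨S, hcard, hcl⟩
    set y : List Bool := List.ofFn fun a : Fin m => decide (a ∈ S) with hy
    have hylen : y.length = m := by simp [hy]
    have hty : y.take m = y := List.take_of_length_le hylen.le
    have hyget : ∀ a : Fin m, y.getD a false = decide (a ∈ S) := fun a => by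
      rw [hy, Kannan.getD_ofFn _ a.2]
    refine ⟨y, by rw [hylen]; exact (Nat.le_mul_self m).trans (Nat.le_add_right _ _), ?_, ?_⟩
    · rw [hty, ← card_filter_range_getD y hylen.le,
        ← card_filter_univ_fin m fun i => y.getD i false = true, ← hcard]
      congr 1
      ext a
      simp only [Finset.mem_filter, Finset.mem_univ, true_and, hyget a, decide_eq_true_iff]
    · intro t ht hab hya hyb
      rw [hty] at hya hyb
      have hbm : t % m < m := Nat.mod_lt _ hm0
      have ham : t / m < m := Nat.div_lt_of_lt_mul ht
      have ha : (⟨t / m, ham⟩ : Fin m) ∈ S := by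
        have h := hyget ⟨t / m, ham⟩
        rwa [h, decide_eq_true_iff] at hya
      have hb : (⟨t % m, hbm⟩ : Fin m) ∈ S := by
        have h := hyget ⟨t % m, hbm⟩
        rwa [h, decide_eq_true_iff] at hyb
      have hw := hcl _ ha _ hb hab (by rw [Nat.mod_add_div]; exact ht)
      rw [Kannan.getD_ofFn (sqPart w) ht, ← hw]
      congr 1
      apply Fin.ext
      exact (Nat.mod_add_div t m).symm

/-- **The slice of the recurring-clique language at length `m² + k` is `CLIQUE(m, k)` of the edge
vector of the square part** (`1 ≤ m`, `k < m`). [cite: AroraBarak2009, §2.1 Ex. 2.2] -/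
theorem sliceFn_recCliqueLang (hm : 1 ≤ m) (hk : k < m) (w : Fin (m * m + k) → Bool) :
    recCliqueLang.sliceFn (m * m + k) w = cliqueFn m k (edgeVec (sqPart w)) := by
  rw [Bool.eq_iff_iff, sliceFn_recCliqueLang_eq_true_iff hm hk, cliqueFn_edgeVec_iff]

/-- The slices of the recurring-clique language at the lengths `m² + k` are monotone (`1 ≤ m`,
`k < m`). [folklore] -/
theorem monotone_sliceFn_recCliqueLang (hm : 1 ≤ m) (hk : k < m) :
    Monotone (recCliqueLang.sliceFn (m * m + k)) := by
  intro x y hxy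
  rw [sliceFn_recCliqueLang hm hk, sliceFn_recCliqueLang hm hk]
  exact (cliqueFn_monotone_holds m _) fun e => hxy (Fin.castLE (Nat.le_add_right _ _) (edgePos e))

/-- **The transfer package at length `m² + k` for the recurring-clique witness** (`2 ≤ k < m`): a
lower bound `s` for every De Morgan circuit with `≤ b` NOT gates computing `CLIQUE(m, k)` gives
`s ≤ negLimitedSizeOver deMorganBasis b (L_{m² + k})`. [folklore] -/
theorem le_negLimitedSizeOver_sliceFn_recClique (hk2 : 2 ≤ k) (hk : k < m) {b s : ℕ}
    (hlow : ∀ D : Circuit (KEdge m), D.IsOver deMorganBasis →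
      D.Computes (cliqueFn m k) → D.negationCount ≤ b → s ≤ D.size) :
    s ≤ negLimitedSizeOver deMorganBasis b (recCliqueLang.sliceFn (m * m + k)) := by
  have hTcl : CliqueLike (univ : Finset (Fin m)) (k - 1) k (cliqueFn m k) :=
    cliqueLike_cliqueFn (m := m) (by omega)
  have e₀ : KEdge m := ⟨s(⟨0, by omega⟩, ⟨1, by omega⟩), by simp [Fin.ext_iff]⟩
  -- the retraction: square positions to edges (diagonal to `e₀`), padding positions to `e₀`
  let ρ : Fin (m * m + k) → KEdge m := fun p =>
    if h : (p : ℕ) < m * m then edgeOfPos e₀ ⟨p, h⟩ else e₀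
  have hρ : ∀ y : KEdge m → Bool, sqPart (fun i => y (ρ i)) = fun p => y (edgeOfPos e₀ p) := by
    intro y
    funext p
    simp only [sqPart, ρ, Fin.val_castLE, dif_pos p.2]
  refine le_negLimitedSizeOver_of_retract (g := cliqueFn m k) ρ (fun y => ?_) ?_ hlow
  · rw [sliceFn_recCliqueLang (by omega) hk, hρ, edgeVec_comp_edgeOfPos]
  · obtain ⟨C₀, hB₀, hC₀⟩ := exists_monotone_circuit_of_cliqueLike hTcl (by omega) hk.le
    refine ⟨C₀.mapInputs fun e => Fin.castLE (Nat.le_add_right _ _) (edgePos e),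
      (hB₀.mapInputs _).mono monotoneBasis_subset_deMorgan, ?_, fun x => ?_⟩
    · rw [negationCount_mapInputs, Circuit.negationCount_eq_zero_of_isOver_monotoneBasis hB₀]
      exact Nat.zero_le _
    · rw [Circuit.eval_mapInputs, hC₀, sliceFn_recCliqueLang (by omega) hk]
      rfl

/-- **Registered stub `stub_recurringCliqueSlicesNP` of line `density-ladder`** (support item
stmt-PneNP-19555): the recurring-clique language is in `NP`, and for every `k ≥ 5` and EVERY
`m > k` (in particular infinitely many), its slice at the length `n = m² + k ∈ [m, m⁴]` is monotone
and carries every negation-limited lower bound for `CLIQUE(m, k)`. [cite: AroraBarak2009, §2.1 Ex. 2.2] -/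
theorem stub_recurringCliqueSlicesNP : RecurringCliqueSlicesNP := by
  refine ⟨recCliqueLang, recCliqueLang_mem_NP, fun k hk m₀ => ?_⟩
  refine ⟨max m₀ (k + 1), le_max_left _ _, max m₀ (k + 1) * max m₀ (k + 1) + k, ?_, ?_, ?_, ?_⟩
  · exact (Nat.le_mul_self _).trans (Nat.le_add_right _ _)
  · have hkm : k < max m₀ (k + 1) := Nat.lt_of_lt_of_le (Nat.lt_succ_self k) (le_max_right _ _)
    have h4 : max m₀ (k + 1) ^ 4 = max m₀ (k + 1) * max m₀ (k + 1) * (max m₀ (k + 1) * max m₀ (k + 1)) := by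
      ring
    rw [h4]
    nlinarith [Nat.le_mul_self (max m₀ (k + 1))]
  · exact monotone_sliceFn_recCliqueLang (by omega) (by omega)
  · intro b s hlow
    exact le_negLimitedSizeOver_sliceFn_recClique (by omega) (by omega) hlow

end Summit.PneNP.PneNP.Theorems.NegLimitedLadder

end
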